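import Summits.QuantumFields.YangMills.Theorems.AllWindowsColdBoxBoxHighLinePhiQuarticLocalForm
import Summits.QuantumFields.YangMills.Theorems.AllWindowsColdBoxBoxHighLineLinCurvSqCentredForm
import Summits.QuantumFields.YangMills.Theorems.AllWindowsColdBoxBoxHighLineGaussCovMainReduction

/-!
# The `Φ⁴` vertex `phiQuartic`: crude (centred) `L²` size under `E₀` — `E₀[phiQuartic²], E₀[(phiQuartic − E₀phiQuartic)²] ≤ C·H⁸·(1+log H)⁴/β⁴`
# (input of the `√τ`-transfer of the K3′ row «E1-Φ» onto `μ_{D′}` — planner ym-idea-2 g18's ruling 2026-08-30T01:19:49Z ★FLAG-1;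
#  `Cruxes/BoxWindowHighSU2213/ASSEMBLY-U5.md` §8; LINE-20 U5 ⟨stmt-QuantumFields-24336⟩)

Width seat `ym-line-sfw-p2-w2` (g33).  Cauchy–Schwarz over sites / colours / the eight edges at a site, and Bonami–Nelson
(✓`gaussAvg_sq_mul_sq_le_of_polyCert`) down to the diagonal propagator (✓`coldBox_propagator_decay`, ✓`Cum3Triangle.gaussAvg_coord_mul_coord`):

* `gaussAvg_sq_sum_le` (`E₀[(Σ_{i∈s}F_i)²] ≤ |s|·ΣE₀[F_i²]`), `gaussAvg_sq_mul_sq_le_of_le`;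
* `gaussAvg_coord_sq_le` (`C(1+log H)/β`), `gaussAvg_coord_pow_four_le`, `gaussAvg_norm_pow_four_le` (`C(1+log H)²/β²`),
  `gaussAvg_divLin_sq_le` (`C(1+log H)/β`), `gaussAvg_divLin_cubeField_sq_le` (`C(1+log H)³/β³`), `gaussAvg_phiSite_sq_le` (`C(1+log H)⁴/β⁴`);
* ★ `gaussAvg_phiQuartic_sq_le`, ★ `gaussAvg_phiQuartic_centred_sq_le` — `≤ C·H⁸·(1+log H)⁴/β⁴` (crude by `H⁴` against the Wick variance `≍ H⁴·polylog/β⁴`;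
  immaterial: it only feeds the `√τ`-summand of the row, whose decay exponent `q` is free in the hKk interface).

Tree only; no definitions; standard axioms.  HONEST LABEL: U5 prep, helper-grade (inputs of ONE K3′ row); U5 ⟨24336⟩ UNSTAFFED/OPEN, ⟨24004⟩ OPEN; route
AllWindowsColdBox DRAFT; no crux, rung or summit is proved; **the Yang–Mills mass gap is NOT proved by this file; no summit is proved by a line.**
-/

set_option autoImplicit false

noncomputable section

open MeasureTheory Matrix Finset
open Literature.Probability.LatticeModels (Site)

namespace Summit.QuantumFields.YangMills.Theorems.AllWindowsColdBoxBoxHighLine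

namespace PhiQuartic

open EdgeChartGaussian (polyCert_const polyCert_coord polyCert_sub polyCert_mul polyCert_pow polyCert_sum polyCert_const_mul
  gaussAvg_sq_mul_sq_le_of_polyCert integrable_polyCert_mul_gaussWeight)
open LaplaceSandwich (flatten)

variable {H : ℕ}

/-! ## §4 Crude `L²` sizes under `E₀` -/

variable {β : ℝ}

/-- **Cauchy–Schwarz under `E₀`**: `E₀[(Σ_{i∈s} F_i)²] ≤ |s| · Σ_{i∈s} E₀[F_i²]` for certified polynomial observables. -/
theorem gaussAvg_sq_sum_le (hβ : 0 < β) {ι : Type*} (s : Finset ι) {F : ι → (LandauFree H → E3) → ℝ} {d : ℕ}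
    (hF : ∀ i ∈ s, ∃ Q : MvPolynomial (LandauFree H × Fin 3) ℝ, Q.totalDegree ≤ d ∧ ∀ a, F i a = MvPolynomial.eval (flatten (LandauFree H) a) Q) :
    gaussAvg β H (fun a => (∑ i ∈ s, F i a) ^ 2) ≤ s.card * ∑ i ∈ s, gaussAvg β H (fun a => F i a ^ 2) := by
  have h1 := EdgeChartGaussian.gaussAvg_mono H hβ (F := fun a => (∑ i ∈ s, F i a) ^ 2) (G := fun a => (s.card : ℝ) * ∑ i ∈ s, F i a ^ 2)
    (fun a => sq_sum_le_card_mul_sum_sq) (integrable_polyCert_mul_gaussWeight H hβ (polyCert_pow (polyCert_sum s hF) 2))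
    (integrable_polyCert_mul_gaussWeight H hβ (polyCert_const_mul _ (polyCert_sum s fun i hi => polyCert_pow (hF i hi) 2)))
  refine h1.trans (le_of_eq ?_)
  rw [EdgeChartGaussian.gaussAvg_const_mul,
    EdgeChartGaussian.gaussAvg_finset_sum β H s (fun i a => F i a ^ 2) fun i hi => integrable_polyCert_mul_gaussWeight H hβ (polyCert_pow (hF i hi) 2)]

/-- Bonami–Nelson with sizes: `E₀[F²] ≤ A`, `E₀[G²] ≤ B` (degrees `p`, `q`) ⇒ `E₀[F²G²] ≤ 3^{p+q}·A·B`. -/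
theorem gaussAvg_sq_mul_sq_le_of_le (hβ : 0 < β) {F G : (LandauFree H → E3) → ℝ} {p q : ℕ}
    (hF : ∃ Q : MvPolynomial (LandauFree H × Fin 3) ℝ, Q.totalDegree ≤ p ∧ ∀ a, F a = MvPolynomial.eval (flatten (LandauFree H) a) Q)
    (hG : ∃ Q : MvPolynomial (LandauFree H × Fin 3) ℝ, Q.totalDegree ≤ q ∧ ∀ a, G a = MvPolynomial.eval (flatten (LandauFree H) a) Q)
    {A B : ℝ} (hA : gaussAvg β H (fun a => F a ^ 2) ≤ A) (hB : gaussAvg β H (fun a => G a ^ 2) ≤ B) :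
    gaussAvg β H (fun a => F a ^ 2 * G a ^ 2) ≤ (3 : ℝ) ^ (p + q) * A * B := by
  have hA0 : 0 ≤ A := (EdgeChartGaussian.gaussAvg_nonneg H hβ fun a => sq_nonneg _).trans hA
  have hn : 0 ≤ gaussAvg β H (fun a => G a ^ 2) := EdgeChartGaussian.gaussAvg_nonneg H hβ fun a => sq_nonneg _
  exact (gaussAvg_sq_mul_sq_le_of_polyCert H hβ hF hG).trans (mul_le_mul (mul_le_mul_of_nonneg_left hA (by positivity)) hB hn (by positivity))

/-- **Diagonal propagator**: `E₀[(a_e^c)²] ≤ C·(1+log H)/β` (✓`coldBox_propagator_decay` on the diagonal). -/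
theorem gaussAvg_coord_sq_le : ∃ C : ℝ, 0 ≤ C ∧ ∀ H : ℕ, 1 ≤ H → ∀ β : ℝ, 0 < β → ∀ (e : LandauFree H) (c : Fin 3),
    gaussAvg β H (fun a => a e c ^ 2) ≤ C * (1 + Real.log H) / β := by
  obtain ⟨C₀, hC⟩ := EdgeChartGaussian.coldBox_propagator_decay
  refine ⟨max C₀ 0 / 2, by positivity, fun H hH β hβ e c => ?_⟩
  have hL : 0 ≤ 1 + Real.log (H : ℝ) := by
    have : (1 : ℝ) ≤ H := by exact_mod_cast hH
    have := Real.log_nonneg this; linarith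
  have h := hC H hH β hβ (e, c) (e, c)
  have hsq : gaussAvg β H (fun a => a e c ^ 2) = gaussAvg β H (fun a => a e c * a e c) := by simp_rw [sq]
  rw [hsq, Cum3Triangle.gaussAvg_coord_mul_coord H hβ (e, c) (e, c)]
  refine (le_abs_self _).trans (h.trans ?_)
  have hden : 1 ≤ (1 + ⨆ k : Fin 4, |(((e, c).1.1.1.1 k - (e, c).1.1.1.1 k : ℤ) : ℝ)|) ^ 2 := by
    refine one_le_pow₀ ?_
    have : 0 ≤ ⨆ k : Fin 4, |(((e, c).1.1.1.1 k - (e, c).1.1.1.1 k : ℤ) : ℝ)| := by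
      simp only [sub_self, Int.cast_zero, abs_zero, ciSup_const, le_refl]
    linarith
  calc (2 * β)⁻¹ * (C₀ * (1 + Real.log H) / (1 + ⨆ k : Fin 4, |(((e, c).1.1.1.1 k - (e, c).1.1.1.1 k : ℤ) : ℝ)|) ^ 2)
      ≤ (2 * β)⁻¹ * (max C₀ 0 * (1 + Real.log H) / (1 + ⨆ k : Fin 4, |(((e, c).1.1.1.1 k - (e, c).1.1.1.1 k : ℤ) : ℝ)|) ^ 2) :=
        mul_le_mul_of_nonneg_left (div_le_div_of_nonneg_right (mul_le_mul_of_nonneg_right (le_max_left _ _) hL) (by positivity)) (by positivity)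
    _ ≤ (2 * β)⁻¹ * (max C₀ 0 * (1 + Real.log H)) := mul_le_mul_of_nonneg_left (div_le_self (by positivity) hden) (by positivity)
    _ = max C₀ 0 / 2 * (1 + Real.log H) / β := by field_simp

/-- `E₀[(a_e^c)⁴] ≤ C·(1+log H)²/β²` (Bonami–Nelson over the diagonal propagator). -/
theorem gaussAvg_coord_pow_four_le : ∃ C : ℝ, 0 ≤ C ∧ ∀ H : ℕ, 1 ≤ H → ∀ β : ℝ, 0 < β → ∀ (e : LandauFree H) (c : Fin 3),
    gaussAvg β H (fun a => a e c ^ 4) ≤ C * (1 + Real.log H) ^ 2 / β ^ 2 := by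
  obtain ⟨C, hC0, hC⟩ := gaussAvg_coord_sq_le
  refine ⟨9 * C ^ 2, by positivity, fun H hH β hβ e c => ?_⟩
  have h := gaussAvg_sq_mul_sq_le_of_le hβ (polyCert_coord e c le_rfl) (polyCert_coord e c le_rfl) (hC H hH β hβ e c) (hC H hH β hβ e c)
  have h4 : gaussAvg β H (fun a => a e c ^ 4) = gaussAvg β H (fun a => a e c ^ 2 * a e c ^ 2) := by
    congr 1; funext a; ring
  rw [h4]
  refine h.trans (le_of_eq ?_)
  have hβ0 : β ≠ 0 := hβ.ne'
  field_simp
  ring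

/-- `E₀[‖a_e‖⁴] ≤ C·(1+log H)²/β²`. -/
theorem gaussAvg_norm_pow_four_le : ∃ C : ℝ, 0 ≤ C ∧ ∀ H : ℕ, 1 ≤ H → ∀ β : ℝ, 0 < β → ∀ e : LandauFree H,
    gaussAvg β H (fun a => (‖a e‖ ^ 2) ^ 2) ≤ C * (1 + Real.log H) ^ 2 / β ^ 2 := by
  obtain ⟨C, hC0, hC⟩ := gaussAvg_coord_pow_four_le
  refine ⟨9 * C, by positivity, fun H hH β hβ e => ?_⟩
  have hcs := gaussAvg_sq_sum_le (H := H) hβ (Finset.univ : Finset (Fin 3)) (d := 2) (F := fun c (a : LandauFree H → E3) => a e c ^ 2)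
    fun c _ => polyCert_pow (polyCert_coord e c le_rfl) 2
  have he : gaussAvg β H (fun a => (‖a e‖ ^ 2) ^ 2) = gaussAvg β H (fun a => (∑ c : Fin 3, a e c ^ 2) ^ 2) := by
    congr 1; funext a; rw [BoxQuadForm.norm_sq_eq_sum]
  rw [he]
  refine hcs.trans ?_
  have hcard : ((Finset.univ : Finset (Fin 3)).card : ℝ) = 3 := by simp
  rw [hcard]
  have hk : ∀ c : Fin 3, gaussAvg β H (fun a => (a e c ^ 2) ^ 2) ≤ C * (1 + Real.log H) ^ 2 / β ^ 2 := fun c => by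
    have := hC H hH β hβ e c
    refine le_trans (le_of_eq ?_) this
    congr 1; funext a; ring
  calc (3 : ℝ) * ∑ c : Fin 3, gaussAvg β H (fun a => (a e c ^ 2) ^ 2) ≤ 3 * ∑ _c : Fin 3, C * (1 + Real.log H) ^ 2 / β ^ 2 :=
        mul_le_mul_of_nonneg_left (Finset.sum_le_sum fun c _ => hk c) (by norm_num)
    _ = 9 * C * (1 + Real.log H) ^ 2 / β ^ 2 := by rw [Finset.sum_const, nsmul_eq_mul, hcard]; ring
set_option maxHeartbeats 400000 in
/-- At an interior site: `E₀[(divLin_x(a)^c)²] ≤ C·(1+log H)/β`. -/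
theorem gaussAvg_divLin_sq_le : ∃ C : ℝ, 0 ≤ C ∧ ∀ H : ℕ, 1 ≤ H → ∀ β : ℝ, 0 < β → ∀ x : Site 4, x ∈ interiorSites H → ∀ c : Fin 3,
    gaussAvg β H (fun a => divLin H x a c ^ 2) ≤ C * (1 + Real.log H) / β := by
  obtain ⟨C, hC0, hC⟩ := gaussAvg_coord_sq_le
  refine ⟨64 * C, by positivity, fun H hH β hβ x hx c => ?_⟩
  have hcs := gaussAvg_sq_sum_le (H := H) hβ (Finset.univ : Finset (Fin 4 ⊕ Fin 4)) (d := 1)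
    (F := fun k (a : LandauFree H → E3) => Sum.elim (fun _ => (1 : ℝ)) (fun _ => -1) k * a (Sum.elim (inEdge hx) (outEdge hx) k) c)
    fun k _ => polyCert_const_mul _ (polyCert_coord _ c le_rfl)
  have he : gaussAvg β H (fun a => divLin H x a c ^ 2) =
      gaussAvg β H (fun a => (∑ k : Fin 4 ⊕ Fin 4, Sum.elim (fun _ => (1 : ℝ)) (fun _ => -1) k * a (Sum.elim (inEdge hx) (outEdge hx) k) c) ^ 2) := by
    congr 1; funext a; rw [divLin_eq_sum_signed hx]
  rw [he]
  refine hcs.trans ?_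
  have hcard : ((Finset.univ : Finset (Fin 4 ⊕ Fin 4)).card : ℝ) = 8 := by simp
  rw [hcard]
  have hk : ∀ k : Fin 4 ⊕ Fin 4, gaussAvg β H (fun a => (Sum.elim (fun _ => (1 : ℝ)) (fun _ => -1) k *
      a (Sum.elim (inEdge hx) (outEdge hx) k) c) ^ 2) ≤ C * (1 + Real.log H) / β := by
    intro k
    have hσ : (Sum.elim (fun _ => (1 : ℝ)) (fun _ => -1) k) ^ 2 = 1 := by rcases k with μ | μ <;> simp
    have : (fun a : LandauFree H → E3 => (Sum.elim (fun _ => (1 : ℝ)) (fun _ => -1) k * a (Sum.elim (inEdge hx) (outEdge hx) k) c) ^ 2) =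
        fun a => a (Sum.elim (inEdge hx) (outEdge hx) k) c ^ 2 := by
      funext a; rw [mul_pow, hσ, one_mul]
    rw [this]; exact hC H hH β hβ _ c
  calc (8 : ℝ) * ∑ k : Fin 4 ⊕ Fin 4, gaussAvg β H (fun a => (Sum.elim (fun _ => (1 : ℝ)) (fun _ => -1) k *
        a (Sum.elim (inEdge hx) (outEdge hx) k) c) ^ 2) ≤ 8 * ∑ _k : Fin 4 ⊕ Fin 4, C * (1 + Real.log H) / β :=
        mul_le_mul_of_nonneg_left (Finset.sum_le_sum fun k _ => hk k) (by norm_num)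
    _ = 64 * C * (1 + Real.log H) / β := by rw [Finset.sum_const, nsmul_eq_mul, hcard]; ring
set_option maxHeartbeats 400000 in
/-- At an interior site: `E₀[(divLin_x(‖a‖²a)^c)²] ≤ C·(1+log H)³/β³`. -/
theorem gaussAvg_divLin_cubeField_sq_le : ∃ C : ℝ, 0 ≤ C ∧ ∀ H : ℕ, 1 ≤ H → ∀ β : ℝ, 0 < β → ∀ x : Site 4, x ∈ interiorSites H →
    ∀ c : Fin 3, gaussAvg β H (fun a => divLin H x (cubeField a) c ^ 2) ≤ C * (1 + Real.log H) ^ 3 / β ^ 3 := by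
  obtain ⟨C, hC0, hC⟩ := gaussAvg_coord_sq_le
  obtain ⟨C', hC0', hC'⟩ := gaussAvg_norm_pow_four_le
  refine ⟨64 * (3 ^ (2 + 1) * C' * C), by positivity, fun H hH β hβ x hx c => ?_⟩
  have hcs := gaussAvg_sq_sum_le (H := H) hβ (Finset.univ : Finset (Fin 4 ⊕ Fin 4)) (d := 2 + 1)
    (F := fun k (a : LandauFree H → E3) => Sum.elim (fun _ => (1 : ℝ)) (fun _ => -1) k *
      (‖a (Sum.elim (inEdge hx) (outEdge hx) k)‖ ^ 2 * a (Sum.elim (inEdge hx) (outEdge hx) k) c))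
    fun k _ => polyCert_const_mul _ (polyCert_mul (GaussNormalForm.polyCert_normSq _) (polyCert_coord _ c le_rfl))
  have he : gaussAvg β H (fun a => divLin H x (cubeField a) c ^ 2) =
      gaussAvg β H (fun a => (∑ k : Fin 4 ⊕ Fin 4, Sum.elim (fun _ => (1 : ℝ)) (fun _ => -1) k *
        (‖a (Sum.elim (inEdge hx) (outEdge hx) k)‖ ^ 2 * a (Sum.elim (inEdge hx) (outEdge hx) k) c)) ^ 2) := by
    congr 1; funext a; rw [divLin_eq_sum_signed hx]; simp_rw [cubeField_apply]
  rw [he]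
  refine hcs.trans ?_
  have hcard : ((Finset.univ : Finset (Fin 4 ⊕ Fin 4)).card : ℝ) = 8 := by simp
  rw [hcard]
  have hk : ∀ k : Fin 4 ⊕ Fin 4, gaussAvg β H (fun a => (Sum.elim (fun _ => (1 : ℝ)) (fun _ => -1) k *
      (‖a (Sum.elim (inEdge hx) (outEdge hx) k)‖ ^ 2 * a (Sum.elim (inEdge hx) (outEdge hx) k) c)) ^ 2) ≤
      3 ^ (2 + 1) * (C' * (1 + Real.log H) ^ 2 / β ^ 2) * (C * (1 + Real.log H) / β) := by
    intro k
    have hσ : (Sum.elim (fun _ => (1 : ℝ)) (fun _ => -1) k) ^ 2 = 1 := by rcases k with μ | μ <;> simp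
    have : (fun a : LandauFree H → E3 => (Sum.elim (fun _ => (1 : ℝ)) (fun _ => -1) k *
        (‖a (Sum.elim (inEdge hx) (outEdge hx) k)‖ ^ 2 * a (Sum.elim (inEdge hx) (outEdge hx) k) c)) ^ 2) =
        fun a => (‖a (Sum.elim (inEdge hx) (outEdge hx) k)‖ ^ 2) ^ 2 * a (Sum.elim (inEdge hx) (outEdge hx) k) c ^ 2 := by
      funext a; rw [mul_pow, hσ, one_mul, mul_pow]
    rw [this]
    exact gaussAvg_sq_mul_sq_le_of_le hβ (GaussNormalForm.polyCert_normSq _) (polyCert_coord _ c le_rfl) (hC' H hH β hβ _) (hC H hH β hβ _ c)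
  calc (8 : ℝ) * ∑ k : Fin 4 ⊕ Fin 4, gaussAvg β H (fun a => (Sum.elim (fun _ => (1 : ℝ)) (fun _ => -1) k *
        (‖a (Sum.elim (inEdge hx) (outEdge hx) k)‖ ^ 2 * a (Sum.elim (inEdge hx) (outEdge hx) k) c)) ^ 2)
      ≤ 8 * ∑ _k : Fin 4 ⊕ Fin 4, 3 ^ (2 + 1) * (C' * (1 + Real.log H) ^ 2 / β ^ 2) * (C * (1 + Real.log H) / β) :=
        mul_le_mul_of_nonneg_left (Finset.sum_le_sum fun k _ => hk k) (by norm_num)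
    _ = 64 * (3 ^ (2 + 1) * C' * C) * (1 + Real.log H) ^ 3 / β ^ 3 := by rw [Finset.sum_const, nsmul_eq_mul, hcard]; ring

/-- The site term: `E₀[(−(1/3)Σ_c divLin·divLin(cubeField))²] ≤ C·(1+log H)⁴/β⁴` at an interior site. -/
theorem gaussAvg_phiSite_sq_le : ∃ C : ℝ, 0 ≤ C ∧ ∀ H : ℕ, 1 ≤ H → ∀ β : ℝ, 0 < β → ∀ x : Site 4, x ∈ interiorSites H →
    gaussAvg β H (fun a => (-(1 / 3 : ℝ) * ∑ c : Fin 3, divLin H x a c * divLin H x (cubeField a) c) ^ 2) ≤ C * (1 + Real.log H) ^ 4 / β ^ 4 := by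
  obtain ⟨Cu, hCu0, hu⟩ := gaussAvg_divLin_sq_le
  obtain ⟨Cv, hCv0, hv⟩ := gaussAvg_divLin_cubeField_sq_le
  refine ⟨3 ^ (1 + 3) * Cu * Cv, by positivity, fun H hH β hβ x hx => ?_⟩
  have hcs := gaussAvg_sq_sum_le (H := H) hβ (Finset.univ : Finset (Fin 3)) (d := 1 + 3)
    (F := fun c (a : LandauFree H → E3) => divLin H x a c * divLin H x (cubeField a) c)
    fun c _ => polyCert_mul (polyCert_divLin x c) (polyCert_divLin_cubeField x c)
  have he : gaussAvg β H (fun a => (-(1 / 3 : ℝ) * ∑ c : Fin 3, divLin H x a c * divLin H x (cubeField a) c) ^ 2) =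
      (1 / 9 : ℝ) * gaussAvg β H (fun a => (∑ c : Fin 3, divLin H x a c * divLin H x (cubeField a) c) ^ 2) := by
    rw [← EdgeChartGaussian.gaussAvg_const_mul]; congr 1; funext a; ring
  rw [he]
  have hcard : ((Finset.univ : Finset (Fin 3)).card : ℝ) = 3 := by simp
  rw [hcard] at hcs
  have hc : ∀ c : Fin 3, gaussAvg β H (fun a => (divLin H x a c * divLin H x (cubeField a) c) ^ 2) ≤
      3 ^ (1 + 3) * (Cu * (1 + Real.log H) / β) * (Cv * (1 + Real.log H) ^ 3 / β ^ 3) := by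
    intro c
    have : (fun a : LandauFree H → E3 => (divLin H x a c * divLin H x (cubeField a) c) ^ 2) =
        fun a => divLin H x a c ^ 2 * divLin H x (cubeField a) c ^ 2 := by funext a; ring
    rw [this]
    exact gaussAvg_sq_mul_sq_le_of_le hβ (polyCert_divLin (H := H) x c) (polyCert_divLin_cubeField (H := H) x c) (hu H hH β hβ x hx c)
      (hv H hH β hβ x hx c)
  calc (1 / 9 : ℝ) * gaussAvg β H (fun a => (∑ c : Fin 3, divLin H x a c * divLin H x (cubeField a) c) ^ 2)
      ≤ (1 / 9 : ℝ) * (3 * ∑ c : Fin 3, gaussAvg β H (fun a => (divLin H x a c * divLin H x (cubeField a) c) ^ 2)) :=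
        mul_le_mul_of_nonneg_left hcs (by norm_num)
    _ ≤ (1 / 9 : ℝ) * (3 * ∑ _c : Fin 3, 3 ^ (1 + 3) * (Cu * (1 + Real.log H) / β) * (Cv * (1 + Real.log H) ^ 3 / β ^ 3)) :=
        mul_le_mul_of_nonneg_left (mul_le_mul_of_nonneg_left (Finset.sum_le_sum fun c _ => hc c) (by norm_num)) (by norm_num)
    _ = 3 ^ (1 + 3) * Cu * Cv * (1 + Real.log H) ^ 4 / β ^ 4 := by rw [Finset.sum_const, nsmul_eq_mul, hcard]; ring

/-- ★ **Crude `L²` size of the `Φ⁴` vertex**: `E₀[phiQuartic²] ≤ C·H⁸·(1+log H)⁴/β⁴`. -/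
theorem gaussAvg_phiQuartic_sq_le : ∃ C : ℝ, 0 ≤ C ∧ ∀ H : ℕ, 1 ≤ H → ∀ β : ℝ, 0 < β →
    gaussAvg β H (fun a => phiQuartic H a ^ 2) ≤ C * (H : ℝ) ^ 8 * (1 + Real.log H) ^ 4 / β ^ 4 := by
  obtain ⟨C, hC0, h⟩ := gaussAvg_phiSite_sq_le
  refine ⟨16 ^ 2 * C, by positivity, fun H hH β hβ => ?_⟩
  have hcs := gaussAvg_sq_sum_le (H := H) hβ (interiorSites H) (d := 4)
    (F := fun x (a : LandauFree H → E3) => -(1 / 3 : ℝ) * ∑ c : Fin 3, divLin H x a c * divLin H x (cubeField a) c) fun x _ => polyCert_phiSite x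
  have he : gaussAvg β H (fun a => phiQuartic H a ^ 2) =
      gaussAvg β H (fun a => (∑ x ∈ interiorSites H, -(1 / 3 : ℝ) * ∑ c : Fin 3, divLin H x a c * divLin H x (cubeField a) c) ^ 2) := by
    congr 1; funext a; rw [phiQuartic_eq_sum_sites]
  rw [he]
  refine hcs.trans ?_
  have hcard := PhiTaylorProof.card_interiorSites_le H
  have hK0 : 0 ≤ C * (1 + Real.log H) ^ 4 / β ^ 4 := by
    have : (1 : ℝ) ≤ H := by exact_mod_cast hH
    have := Real.log_nonneg this
    positivity
  have hS : ∑ x ∈ interiorSites H, gaussAvg β H (fun a => (-(1 / 3 : ℝ) * ∑ c : Fin 3, divLin H x a c * divLin H x (cubeField a) c) ^ 2) ≤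
      (interiorSites H).card * (C * (1 + Real.log H) ^ 4 / β ^ 4) := by
    refine (Finset.sum_le_sum fun x hx => h H hH β hβ x hx).trans (le_of_eq ?_)
    rw [Finset.sum_const, nsmul_eq_mul]
  calc ((interiorSites H).card : ℝ) * ∑ x ∈ interiorSites H, gaussAvg β H (fun a =>
        (-(1 / 3 : ℝ) * ∑ c : Fin 3, divLin H x a c * divLin H x (cubeField a) c) ^ 2)
      ≤ (16 * (H : ℝ) ^ 4) * ((16 * (H : ℝ) ^ 4) * (C * (1 + Real.log H) ^ 4 / β ^ 4)) :=
        mul_le_mul hcard (hS.trans (mul_le_mul_of_nonneg_right hcard hK0))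
          (Finset.sum_nonneg fun x _ => EdgeChartGaussian.gaussAvg_nonneg H hβ fun a => sq_nonneg _) (by positivity)
    _ = 16 ^ 2 * C * (H : ℝ) ^ 8 * (1 + Real.log H) ^ 4 / β ^ 4 := by ring

/-- ★ **Centred crude `L²` size**: `E₀[(phiQuartic − E₀ phiQuartic)²] ≤ 4·C·H⁸·(1+log H)⁴/β⁴`. -/
theorem gaussAvg_phiQuartic_centred_sq_le : ∃ C : ℝ, 0 ≤ C ∧ ∀ H : ℕ, 1 ≤ H → ∀ β : ℝ, 0 < β →
    gaussAvg β H (fun a => (phiQuartic H a - gaussAvg β H (phiQuartic H)) ^ 2) ≤ C * (H : ℝ) ^ 8 * (1 + Real.log H) ^ 4 / β ^ 4 := by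
  obtain ⟨C, hC0, h⟩ := gaussAvg_phiQuartic_sq_le
  refine ⟨4 * C, by positivity, fun H hH β hβ => ?_⟩
  set m := gaussAvg β H (phiQuartic H) with hm
  have c1 := polyCert_phiQuartic H
  have i2 : Integrable (fun a => phiQuartic H a ^ 2 * gaussWeight β H a) := integrable_polyCert_mul_gaussWeight H hβ (polyCert_pow c1 2)
  have i1 : Integrable (fun a => phiQuartic H a * gaussWeight β H a) := integrable_polyCert_mul_gaussWeight H hβ c1
  have hm2 : m ^ 2 ≤ gaussAvg β H (fun a => phiQuartic H a ^ 2) := by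
    have h1 := EdgeChartGaussian.abs_gaussAvg_le_sqrt H hβ i2 i1
    have hn : 0 ≤ gaussAvg β H (fun a => phiQuartic H a ^ 2) := EdgeChartGaussian.gaussAvg_nonneg H hβ fun a => sq_nonneg _
    rw [hm, ← sq_abs]
    calc |gaussAvg β H (phiQuartic H)| ^ 2 ≤ (Real.sqrt (gaussAvg β H (fun a => phiQuartic H a ^ 2))) ^ 2 :=
          pow_le_pow_left₀ (abs_nonneg _) h1 2
      _ = gaussAvg β H (fun a => phiQuartic H a ^ 2) := Real.sq_sqrt hn
  have hpt : ∀ a, (phiQuartic H a - m) ^ 2 ≤ 2 * phiQuartic H a ^ 2 + 2 * m ^ 2 := fun a => by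
    nlinarith [sq_nonneg (phiQuartic H a + m)]
  have iG2 : Integrable (fun a => 2 * phiQuartic H a ^ 2 * gaussWeight β H a) :=
    integrable_polyCert_mul_gaussWeight H hβ (polyCert_const_mul 2 (polyCert_pow c1 2))
  have iK : Integrable (fun a : LandauFree H → E3 => 2 * m ^ 2 * gaussWeight β H a) :=
    integrable_polyCert_mul_gaussWeight H hβ (polyCert_const (2 * m ^ 2) 0)
  have hmono := EdgeChartGaussian.gaussAvg_mono H hβ hpt
    (integrable_polyCert_mul_gaussWeight H hβ (polyCert_pow (polyCert_sub c1 (polyCert_const m 4)) 2))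
    (integrable_polyCert_mul_gaussWeight H hβ (EdgeChartGaussian.polyCert_add (polyCert_const_mul 2 (polyCert_pow c1 2)) (polyCert_const (2 * m ^ 2) _)))
  have hsplit : gaussAvg β H (fun a => 2 * phiQuartic H a ^ 2 + 2 * m ^ 2) = 2 * gaussAvg β H (fun a => phiQuartic H a ^ 2) + 2 * m ^ 2 := by
    rw [EdgeChartGaussian.gaussAvg_add β H iG2 iK, EdgeChartGaussian.gaussAvg_const_mul, EdgeChartGaussian.gaussAvg_const_fun H hβ]
  rw [hsplit] at hmono
  have hF := h H hH β hβ
  calc gaussAvg β H (fun a => (phiQuartic H a - m) ^ 2) ≤ 2 * gaussAvg β H (fun a => phiQuartic H a ^ 2) + 2 * m ^ 2 := hmono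
    _ ≤ 4 * gaussAvg β H (fun a => phiQuartic H a ^ 2) := by linarith
    _ ≤ 4 * (C * (H : ℝ) ^ 8 * (1 + Real.log H) ^ 4 / β ^ 4) := mul_le_mul_of_nonneg_left hF (by norm_num)
    _ = 4 * C * (H : ℝ) ^ 8 * (1 + Real.log H) ^ 4 / β ^ 4 := by ring

end PhiQuartic

end Summit.QuantumFields.YangMills.Theorems.AllWindowsColdBoxBoxHighLine
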